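import Mathlib
import Summits.ValiantsHypothesis.ValiantsHypothesis.Theorems.NewtonUnitEquationsDissociatedUniformTotalsLawUnimodal
import HarnessLib

/-!
# Crux `NewtonUnitEquations.DissociatedUniform` (stmt-ValiantsHypothesis-5905): the POINTWISE union bound on the convexly ordered stratum — typed and located

Companion of `…TotalsLawUnimodal` (union totals law on the convexly ordered stratum with constant `2 + #bdry Z`,
`unionTotal_le_of_convexlyOrdered'`).  The boundary term there is an artefact of the proof (the walk exits the present
fibres only through run endpoints): the census of this seat (memo `Cruxes/DissociatedUniform/NOTES-t1g5.md` §3; scripts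
`exp/manyruns.py`, `exp/anneal_W.py`, `exp/anneal_W_degen.py`) finds, for BOTH curves convexly ordered and position sets with
MANY runs (random `Z` of density `1/4 … 3/4`, `3ℤ`, `2`-blocks; `q ≤ 101`), `UT/q² ≤ 1.73` and `max_s #vert U_s ≤ 1.8 q`, and
ANNEALING the fibre set `W` to maximise `#vert conv ⋃_{r∈W} P_r` (strictly convex polygon pairs, co- and contra-oriented, parabola
pairs; `q = 13, 17, 23`) reaches EXACTLY `#vert A + #vert B = 2q` (often with `|W| < q`) and never more; degenerate convexly ordered
pairs (collinear runs) exceed `#vert A + #vert B` but stay `≤ 2q`.  So the located next rung on this stratum is POINTWISE: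

* `@[conjecture] ConvexUnionVertBound C` : for all `q`, all convexly ordered `a b : ℤ/q → ℝ²`, every fibre set `W` and class `s`,
  `#vert conv U_s(W) ≤ C·q` — a Minkowski-type bound for ARBITRARY unions of fibres (`W = G` is Minkowski's `#vert(A+B) ≤ 2q`;
  census: `C = 2` holds and is attained).  OPEN; asserted nowhere.
* `unionTotal_le_of_convexUnionVertBound` : it gives the union totals law with constant `C` on the whole stratum (every `Z`), and
  `two_le_of_convexUnionVertBound` : `C ≥ 2` is necessary (the unit-square letters over `ℤ/2`: `#vert (A + B) = 4 = 2q`).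
Honest label: a typed conjecture + bookkeeping; nothing here bears on the open laws for general labellings or on VP ≠ VNP.
[folklore]
-/

set_option linter.dupNamespace false -- `ValiantsHypothesis.ValiantsHypothesis` (summit = problem) in every name

open scoped BigOperators Pointwise

namespace Summit.ValiantsHypothesis.ValiantsHypothesis.Theorems.NewtonUnitEquationsDissociatedUniform

namespace TotalsLaw

open Literature.Computability.AlgebraicComplexity.KPTT.PlanarMinkowski

/-- **Pointwise Minkowski-type bound for fibre unions on the convexly ordered stratum** (conjecture-grade, OPEN; census of
NOTES-t1g5 §3: `C = 2` holds in all data and is attained): for both curves convexly ordered, EVERY union of fibres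
`U_s(W) = ⋃_{z ∈ W} P_{s-z}` has at most `C·q` hull vertices.  Not asserted anywhere. -/
@[conjecture] def ConvexUnionVertBound (C : ℕ) : Prop :=
  ∀ (q : ℕ) [NeZero q] (a b : ZMod q → (Fin 2 → ℝ)), ConvexlyOrdered a → ConvexlyOrdered b →
    ∀ (W : Finset (ZMod q)) (s : ZMod q), unionVert a b (W : Set (ZMod q)) s ≤ C * q

/-- The pointwise bound gives the union totals law with the same constant on the whole convexly ordered stratum (every position
set, any number of runs). -/
theorem unionTotal_le_of_convexUnionVertBound {C : ℕ} (h : ConvexUnionVertBound C) {q : ℕ} [NeZero q]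
    (a b : ZMod q → (Fin 2 → ℝ)) (ha : ConvexlyOrdered a) (hb : ConvexlyOrdered b) (Z : Finset (ZMod q)) :
    unionTotal a b (Z : Set (ZMod q)) ≤ C * q ^ 2 := by
  unfold unionTotal
  calc ∑ s, unionVert a b (Z : Set (ZMod q)) s ≤ ∑ _s : ZMod q, C * q := Finset.sum_le_sum fun s _ => h q a b ha hb Z s
    _ = C * q ^ 2 := by rw [Finset.sum_const, Finset.card_univ, ZMod.card, smul_eq_mul]; ring

/-- Every function on `ℤ/2` is cyclically unimodal (mode at the larger value), so every curve `ℤ/2 → ℝ²` is convexly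
ordered. [folklore] -/
theorem cycUnimodal_zmod_two (f : ZMod 2 → ℝ) : CycUnimodal f := by
  rcases le_total (f 0) (f 1) with h | h
  · refine ⟨0, 1, by decide, fun k hk => ?_, fun k hk hk1 => by omega⟩
    have hk0 : k = 0 := by omega
    subst hk0
    simpa using h
  · refine ⟨1, 1, by decide, fun k hk => ?_, fun k hk hk1 => by omega⟩
    have hk0 : k = 0 := by omega
    subst hk0
    have h11 : (1 : ZMod 2) + 1 = 0 := by decide
    simpa [h11] using h

/-- **`C ≥ 2` is necessary** in the pointwise bound: the unit-square letters `sqA, sqB` over `ℤ/2` of `…TotalsLawSharpness` are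
convexly ordered and their full union `A + B` is the unit square with `4 = 2q` vertices. -/
theorem two_le_of_convexUnionVertBound {C : ℕ} (h : ConvexUnionVertBound C) : 2 ≤ C := by
  have hA : ConvexlyOrdered sqA := fun _ => cycUnimodal_zmod_two _
  have hB : ConvexlyOrdered sqB := fun _ => cycUnimodal_zmod_two _
  have h4 := h 2 sqA sqB hA hB Finset.univ 0
  rw [Finset.coe_univ, unionVert_univ_eq_classVert_zero] at h4
  have := four_le_classVert (0 : ZMod 2)
  omega

end TotalsLaw

end Summit.ValiantsHypothesis.ValiantsHypothesis.Theorems.NewtonUnitEquationsDissociatedUniform
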